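import Literature.Geometry.Lorentzian.CoordSigma2LaplacianEstimate
import Literature.Geometry.Lorentzian.CoordSigma2PathBounds
import HarnessLib

/-!
# The local Laplacian estimate for the `σ₂`-path equation in coordinates, on a compact set

Support file for the named fact
`Literature.Geometry.Riemannian.gurskyViaclovsky_hessianEstimate_weighted_four`
(Gursky–Viaclovsky 2003, Prop. 6; S. Chen 2005, Thm. 1(a) and Cor. 2). Everything manifold-free
is assembled here: for metric components `G`, `C^∞`, symmetric and positive definite on an open
`V` of a model space of dimension `n ≥ 2`, a compact `K ⊆ V`, smooth nonnegative `ω` and smooth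
`q ≥ q₀ > 0` on `K`, and levels `C₀, C₁, δ ≤ 1`, there is ONE constant `C` such that for every
`t ∈ [δ, 1]` and every smooth `f` on `V` solving the path equation in the form
`½(c_t (tr_G W)² − |W|²_G) = ω/16 + (q/4) e^{4f}` on `V`, `c_t = 1 + 3(1−t)(2−t)`,
`W = Hess f + df⊗df − ½|∇f|²G + ½(Ric − (R/6)G)`, with `tr_G W > 0` on `V`: at every local
maximum `y₀ ∈ K` of `Δf + |∇f|²` with `|f(y₀)| ≤ C₀`, `|∇f|²(y₀) ≤ C₁` one has `Δf(y₀) ≤ C`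
(`IsMetricOn.exists_lapAt_le_at_isLocalMax`). The constant is the explicit polynomial of
`IsMetricOn.normSqAt_hessAt_le_of_isLocalMax_of_norm` (`CoordSigma2LaplacianEstimate.lean`) in
the suprema over `K` of the operator norms of `G, G⁻¹, Rm, DRm, Γ, ∇B, D∇B, dω, Δω, q, dq, Δq`
(continuity and compactness), fed through the entry bounds of `CoordSigma2PathBounds.lean`.
On a compact manifold, read in finitely many charts, this is the Laplacian bound behind the
`C²` estimate. Everything is proved; no definition and no named fact is introduced.

## References

* S. Chen, *Local estimates for some fully nonlinear elliptic equations*, IMRN 2005:63, Thm. 1(a),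
  Cor. 2, §3. [Chen2005]
* M. J. Gursky, J. A. Viaclovsky, J. Differential Geom. 63 (2003) 131–154, §5, Prop. 6.
  [GurskyViaclovsky2003]
-/

noncomputable section

set_option maxSynthPendingDepth 3

open Set Filter ContinuousLinearMap Module Finset
open scoped Topology ContDiff

namespace Literature.Geometry.Lorentzian

namespace MetricCoord

variable {E : Type*} [NormedAddCommGroup E] [NormedSpace ℝ E] [CompleteSpace E]
  [FiniteDimensional ℝ E] {G : E → E →L[ℝ] E →L[ℝ] ℝ} {V : Set E}

/-- `a ≤ (1 + a²)/2`. [folklore] -/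
private theorem le_half_one_add_sq (a : ℝ) : a ≤ (1 + a ^ 2) / 2 := by
  nlinarith [sq_nonneg (a - 1)]

omit [NormedSpace ℝ E] [CompleteSpace E] [FiniteDimensional ℝ E] in
/-- A uniform bound on a compact set for a field continuous on an open superset, made `≥ 0`.
[folklore] -/
private theorem exists_norm_le_of_continuousOn {F : Type*} [NormedAddCommGroup F] {φ : E → F}
    {K : Set E} (hK : IsCompact K) (hφ : ContinuousOn φ K) :
    ∃ C : ℝ, 0 ≤ C ∧ ∀ y ∈ K, ‖φ y‖ ≤ C := by
  obtain ⟨C, hC⟩ := hK.exists_bound_of_continuousOn hφ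
  exact ⟨max C 0, le_max_right _ _, fun y hy ↦ (hC y hy).trans (le_max_left _ _)⟩

set_option maxHeartbeats 4000000 in
/-- **The local Laplacian estimate for the `σ₂`-path equation in coordinates** (Chen 2005,
Thm. 1(a) / Cor. 2 specialised to Gursky–Viaclovsky's weighted `σ₂`-path, `η ≡ 1`, the gradient
bound being given): see the module docstring. The constant `C` depends only on `G` through the
suprema over `K` of finitely many operator norms, on `ω, q` through `C²` bounds over `K` and `q₀`,
and on `n, δ, C₀, C₁` — not on `t ∈ [δ, 1]` nor on the solution `f`.
[cite: Chen2005, Thm. 1(a), Cor. 2, §3] [cite: GurskyViaclovsky2003, Prop. 6] -/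
theorem IsMetricOn.exists_lapAt_le_at_isLocalMax (hG : IsMetricOn G V) (hn : 2 ≤ finrank ℝ E)
    (hpos : ∀ y ∈ V, ∀ v, v ≠ 0 → 0 < G y v v) {K : Set E} (hK : IsCompact K) (hKV : K ⊆ V)
    {wf qf : E → ℝ} (hwf : ContDiffOn ℝ ∞ wf V) (hqf : ContDiffOn ℝ ∞ qf V)
    (hwf0 : ∀ y ∈ V, 0 ≤ wf y) {q₀ : ℝ} (hq₀ : 0 < q₀) (hq : ∀ y ∈ K, q₀ ≤ qf y)
    (C₀ C₁ δ : ℝ) (hC₁ : 0 ≤ C₁) :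
    ∃ C : ℝ, ∀ (t : ℝ), δ ≤ t → t ≤ 1 →
      ∀ (f : E → ℝ) (W : E → E →L[ℝ] E →L[ℝ] ℝ), ContDiffOn ℝ ∞ f V →
        W = (fun y ↦ hessAt G f y
          + ContinuousLinearMap.smulRightL ℝ E (E →L[ℝ] ℝ) (fderiv ℝ f y) (fderiv ℝ f y)
          - (1 / 2 : ℝ) • (gradSqAt G f y • G y)
          + (1 / 2 : ℝ) • (ricAt G y - (scalAt G y / 6) • G y)) →
        (∀ y ∈ V, 1 / 2 * ((1 + 3 * ((1 - t) * (2 - t))) * mtrAt G y (W y) ^ 2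
          - pairAt G y (W y) (W y)) = 1 / 16 * wf y + 1 / 4 * (qf y * Real.exp (4 * f y))) →
        (∀ y ∈ V, 0 < mtrAt G y (W y)) →
        ∀ y₀ ∈ K, |f y₀| ≤ C₀ → gradSqAt G f y₀ ≤ C₁ →
          IsLocalMax (fun y ↦ lapAt G f y + gradSqAt G f y) y₀ → lapAt G f y₀ ≤ C := by
  classical
  -- the background field `B = ½(Ric − (R/6) G)`
  set Bf : E → E →L[ℝ] E →L[ℝ] ℝ := fun y ↦ (1 / 2 : ℝ) • (ricAt G y - (scalAt G y / 6) • G y)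
    with hBf
  have hB : ContDiffOn ℝ ∞ Bf V := by
    refine fun y hy ↦ ((hG.contDiffOn_ricAt y hy).sub ?_).const_smul _
    exact ((hG.contDiffOn_scalAt y hy).div_const 6).smul (hG.contDiffOn y hy)
  have hBs : ∀ y ∈ V, ∀ v w, Bf y v w = Bf y w v := by
    intro y hy v w
    simp only [hBf, _root_.smul_apply, _root_.sub_apply, smul_eq_mul]
    rw [hG.ricAt_comm hy v w, hG.symm y hy v w]
  have hτ : ContDiffOn ℝ ∞ (cov₂At G Bf) V := hG.contDiffOn_cov₂At hB
  -- uniform bounds on `K` (continuity and compactness)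
  have hVo : IsOpen V := hG.isOpen
  obtain ⟨KG, hKG0, hKG⟩ := exists_norm_le_of_continuousOn hK (hG.contDiffOn.continuousOn.mono hKV)
  obtain ⟨Ks, hKs0, hKs⟩ := exists_norm_le_of_continuousOn hK (hG.contDiffOn_sharpAt.continuousOn.mono hKV)
  obtain ⟨KR, hKR0, hKR⟩ := exists_norm_le_of_continuousOn hK (hG.contDiffOn_riemCLM.continuousOn.mono hKV)
  obtain ⟨KDR, hKDR0, hKDR⟩ := exists_norm_le_of_continuousOn hK
    ((hG.contDiffOn_riemCLM.continuousOn_fderiv_of_isOpen hVo (by simp)).mono hKV)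
  obtain ⟨KΓ, hKΓ0, hKΓ⟩ := exists_norm_le_of_continuousOn hK (hG.contDiffOn_chrAt.continuousOn.mono hKV)
  obtain ⟨KB1, hKB10, hKB1⟩ := exists_norm_le_of_continuousOn hK (hτ.continuousOn.mono hKV)
  obtain ⟨KB2, hKB20, hKB2⟩ := exists_norm_le_of_continuousOn hK
    ((hτ.continuousOn_fderiv_of_isOpen hVo (by simp)).mono hKV)
  obtain ⟨Kw1, hKw10, hKw1⟩ := exists_norm_le_of_continuousOn hK
    ((hwf.continuousOn_fderiv_of_isOpen hVo (by simp)).mono hKV)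
  obtain ⟨Kw2, hKw20, hKw2⟩ := exists_norm_le_of_continuousOn hK
    ((hG.contDiffOn_lapAt hwf).continuousOn.mono hKV)
  obtain ⟨Kq0, hKq00, hKq0⟩ := exists_norm_le_of_continuousOn hK (hqf.continuousOn.mono hKV)
  obtain ⟨Kq1, hKq10, hKq1⟩ := exists_norm_le_of_continuousOn hK
    ((hqf.continuousOn_fderiv_of_isOpen hVo (by simp)).mono hKV)
  obtain ⟨Kq2, hKq20, hKq2⟩ := exists_norm_le_of_continuousOn hK
    ((hG.contDiffOn_lapAt hqf).continuousOn.mono hKV)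
  -- the constants (opaque local definitions)
  obtain ⟨Kq, hKqdef⟩ : ∃ K : ℝ, K = Kq0 + Kq1 + Kq2 := ⟨_, rfl⟩
  have hKq0' : 0 ≤ Kq := by rw [hKqdef]; positivity
  obtain ⟨κ, hκdef⟩ : ∃ κ : ℝ, κ = max 1 (Ks * ((1 + KG) / 2)) := ⟨_, rfl⟩
  have hκ1 : 1 ≤ κ := by rw [hκdef]; exact le_max_left _ _
  have hκ0 : 0 ≤ κ := zero_le_one.trans hκ1
  obtain ⟨Kd, hKddef⟩ : ∃ K : ℝ, K = (finrank ℝ E : ℝ) * (KG * κ * ((1 + C₁) / 2)) := ⟨_, rfl⟩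
  have hKd0 : 0 ≤ Kd := by rw [hKddef]; positivity
  obtain ⟨KΦ1, hKΦ1def⟩ : ∃ K : ℝ,
      K = |1 / 16| * Kw1 + |1 / 4| * Kq * Real.exp (4 * C₀) * (1 + 4 * Kd) := ⟨_, rfl⟩
  obtain ⟨AΦ, hAΦdef⟩ : ∃ K : ℝ,
      K = |1 / 16| * Kw2 + |1 / 4| * Kq * Real.exp (4 * C₀) * (16 * C₁ + 1 + 8 * Ks * Kd) := ⟨_, rfl⟩
  obtain ⟨BΦ, hBΦdef⟩ : ∃ K : ℝ, K = |1 / 4| * Kq * Real.exp (4 * C₀) * 4 := ⟨_, rfl⟩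
  have hKΦ10 : 0 ≤ KΦ1 := by rw [hKΦ1def]; positivity
  have hAΦ0 : 0 ≤ AΦ := by rw [hAΦdef]; positivity
  have hBΦ0 : 0 ≤ BΦ := by rw [hBΦdef]; positivity
  have hP1 : 0 ≤ 3 * KB1 * KΓ := by positivity
  have hP2 : 0 ≤ KG * KR := by positivity
  have hP3 : 0 ≤ KG * (KDR + 4 * KΓ * KR) := by positivity
  obtain ⟨Kall, hKalldef⟩ : ∃ K : ℝ, K = 1 + C₁ + KB1 + (KB2 + 3 * KB1 * KΓ) + KG * KR
      + KG * (KDR + 4 * KΓ * KR) + KΦ1 + (AΦ + BΦ) := ⟨_, rfl⟩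
  have hKall1 : 1 ≤ Kall := by
    rw [hKalldef]; linarith only [hC₁, hKB10, hKB20, hKΦ10, hAΦ0, hBΦ0, hP1, hP2, hP3]
  obtain ⟨c₁, hc₁def⟩ : ∃ c : ℝ, c = 1 + 3 * ((1 - δ) * (2 - δ)) := ⟨_, rfl⟩
  obtain ⟨Φ₀, hΦ₀def⟩ : ∃ c : ℝ, c = 1 / 4 * q₀ * Real.exp (-(4 * C₀)) := ⟨_, rfl⟩
  have hΦ₀ : 0 < Φ₀ := by rw [hΦ₀def]; positivity
  obtain ⟨Cfin, hCfin⟩ : ∃ c : ℝ, c =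
    (2 * (((Kall * κ ^ 5) + (finrank ℝ E : ℝ) * (Kall * κ ^ 5) ^ 2 / (2 * Φ₀) + 2 * (finrank ℝ E : ℝ) * (Kall * κ ^ 5) ^ 2) * ((1 + c₁ / (2 * Φ₀)) / 2) + 19 * c₁ * (finrank ℝ E : ℝ) ^ 4 * (Kall * κ ^ 5) ^ 3)
        + (finrank ℝ E : ℝ) ^ 2 * ((Kall * κ ^ 5) * ((1 + c₁ / (2 * Φ₀)) / 2) + 24 * c₁ * (finrank ℝ E : ℝ) ^ 3 * (Kall * κ ^ 5) ^ 2) ^ 2) := ⟨_, rfl⟩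
  refine ⟨(1 + (finrank ℝ E : ℝ) * Cfin) / 2, ?_⟩
  intro t ht1 ht2 f W hf hW heq hw y₀ hy₀ hf0 hγ hmax
  have hy : y₀ ∈ V := hKV hy₀
  have hi : (G y₀).IsInvertible := hG.isInvertible y₀ hy
  have hs : ∀ v w, G y₀ v w = G y₀ w v := hG.symm y₀ hy
  have hposy := hpos y₀ hy
  have hnn : ∀ v, 0 ≤ G y₀ v v := fun v ↦ by
    by_cases hv : v = 0
    · simp [hv]
    · exact (hposy v hv).le
  obtain ⟨e, he⟩ := exists_orthonormal_basis hs hposy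
  -- frame norms
  have heκ : ∀ a, ‖e a‖ ≤ κ := fun a ↦ by
    have h1 := norm_le_of_apply_self_eq_one hi hs hnn (v := e a) (by rw [he, if_pos rfl])
    rw [hκdef]
    refine h1.trans (le_trans ?_ (le_max_right _ _))
    exact mul_le_mul (hKs y₀ hy₀) (by linarith only [hKG y₀ hy₀]) (by positivity) hKs0
  -- smoothness at `y₀`
  have hfy : ContDiffAt ℝ ∞ f y₀ := (hf y₀ hy).contDiffAt (hG.mem_nhds hy)
  have hwfy : ContDiffAt ℝ ∞ wf y₀ := (hwf y₀ hy).contDiffAt (hG.mem_nhds hy)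
  have hqfy : ContDiffAt ℝ ∞ qf y₀ := (hqf y₀ hy).contDiffAt (hG.mem_nhds hy)
  have hfd : DifferentiableAt ℝ f y₀ := hfy.differentiableAt (by simp)
  have hwfd : DifferentiableAt ℝ wf y₀ := hwfy.differentiableAt (by simp)
  have hqfd : DifferentiableAt ℝ qf y₀ := hqfy.differentiableAt (by simp)
  -- `|df(X)| ≤ Kd ‖X‖` and `‖df‖ ≤ Kd`
  have hDf : ∀ X, |fderiv ℝ f y₀ X| ≤ Kd * ‖X‖ := by
    intro X
    have h := abs_fderiv_le_of_gradSqAt_le e he hi hs (f := f) hκ0 heκ hγ X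
    rw [Fintype.card_fin] at h
    refine h.trans (mul_le_mul_of_nonneg_right ?_ (norm_nonneg _))
    rw [hKddef]
    gcongr
    exact hKG y₀ hy₀
  have hDfn : ‖fderiv ℝ f y₀‖ ≤ Kd :=
    ContinuousLinearMap.opNorm_le_bound _ hKd0 fun X ↦ (Real.norm_eq_abs _).symm ▸ hDf X
  -- constants for `q`
  have hq0' : |qf y₀| ≤ Kq := by
    have := hKq0 y₀ hy₀; rw [Real.norm_eq_abs] at this; rw [hKqdef]
    linarith only [this, hKq10, hKq20]
  have hq1' : ‖fderiv ℝ qf y₀‖ ≤ Kq := by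
    have := hKq1 y₀ hy₀; rw [hKqdef]; linarith only [this, hKq00, hKq20]
  have hq2' : |lapAt G qf y₀| ≤ Kq := by
    have := hKq2 y₀ hy₀; rw [Real.norm_eq_abs] at this; rw [hKqdef]
    linarith only [this, hKq00, hKq10]
  have hw2' : |lapAt G wf y₀| ≤ Kw2 := by have := hKw2 y₀ hy₀; rwa [Real.norm_eq_abs] at this
  -- the parameter `c_t`
  have h1t : 0 ≤ 1 - t := by linarith only [ht2]
  have h2t : 0 ≤ 2 - t := by linarith only [ht2]
  have hc : (1 : ℝ) ≤ 1 + 3 * ((1 - t) * (2 - t)) := by linarith only [mul_nonneg h1t h2t]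
  have hcc₁ : 1 + 3 * ((1 - t) * (2 - t)) ≤ c₁ := by
    rw [hc₁def]
    have h3t : (0 : ℝ) ≤ 3 - δ - t := by linarith only [ht1, ht2]
    linarith only [mul_nonneg (sub_nonneg.2 ht1) h3t]
  -- the right-hand side at `y₀`
  have hΦ₀le : Φ₀ ≤ 1 / 16 * wf y₀ + 1 / 4 * (qf y₀ * Real.exp (4 * f y₀)) := by
    have := rhs_ge (x := y₀) (1 / 16) (1 / 4) (by norm_num)
      (mul_nonneg (by norm_num) (hwf0 y₀ hy)) hq₀.le (hq y₀ hy₀) hf0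
    rw [hΦ₀def]; exact this
  -- the estimate
  have hγ0 : 0 ≤ gradSqAt G f y₀ := by
    rw [gradSqAt_eq_sum_frame e he hi hs f]; positivity
  have hN := hG.normSqAt_hessAt_le_of_isLocalMax_of_norm hy hf hB hBs hW hposy e he
    (Φ := fun y ↦ 1 / 16 * wf y + 1 / 4 * (qf y * Real.exp (4 * f y)))
    (c := 1 + 3 * ((1 - t) * (2 - t))) (c₁ := c₁) (K := Kall) (κ := κ) (Φ₀ := Φ₀)
    hc hcc₁ heq hΦ₀ hΦ₀le (hw y₀ hy) hmax (by rwa [Fintype.card_fin]) hκ1 heκ hKall1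
    ?hγ ?hB1 ?hB2 ?hR ?hDR ?hΦ1 ?hΦ2
  case hγ =>
    calc gradSqAt G f y₀ ≤ C₁ := hγ
      _ ≤ Kall := by
        rw [hKalldef]; linarith only [hKB10, hKB20, hKΦ10, hAΦ0, hBΦ0, hP1, hP2, hP3]
      _ ≤ Kall ^ 2 := by
        rw [sq]; exact le_mul_of_one_le_left (zero_le_one.trans hKall1) hKall1
  case hB1 =>
    intro X Y U
    have h1 : |cov₂At G Bf y₀ X Y U| ≤ ‖cov₂At G Bf y₀‖ * ‖X‖ * ‖Y‖ * ‖U‖ := by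
      rw [← Real.norm_eq_abs]
      calc ‖cov₂At G Bf y₀ X Y U‖ ≤ ‖cov₂At G Bf y₀ X Y‖ * ‖U‖ := (cov₂At G Bf y₀ X Y).le_opNorm U
        _ ≤ ‖cov₂At G Bf y₀ X‖ * ‖Y‖ * ‖U‖ := by gcongr; exact (cov₂At G Bf y₀ X).le_opNorm Y
        _ ≤ ‖cov₂At G Bf y₀‖ * ‖X‖ * ‖Y‖ * ‖U‖ := by gcongr; exact (cov₂At G Bf y₀).le_opNorm X
    refine h1.trans ?_
    have h2 : ‖cov₂At G Bf y₀‖ ≤ Kall := (hKB1 y₀ hy₀).trans (by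
      rw [hKalldef]; linarith only [hC₁, hKB20, hKΦ10, hAΦ0, hBΦ0, hP1, hP2, hP3])
    gcongr
  case hB2 =>
    intro X Y U U'
    refine (abs_cov₃At_le (G := G) (x := y₀) (cov₂At G Bf) X Y U U').trans ?_
    have h2 : ‖fderiv ℝ (cov₂At G Bf) y₀‖ + 3 * ‖cov₂At G Bf y₀‖ * ‖chrAt G y₀‖ ≤ Kall := by
      have a1 := hKB2 y₀ hy₀
      have a2 := hKB1 y₀ hy₀
      have a3 := hKΓ y₀ hy₀
      have : 3 * ‖cov₂At G Bf y₀‖ * ‖chrAt G y₀‖ ≤ 3 * KB1 * KΓ := by gcongr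
      rw [hKalldef]; linarith only [a1, this, hC₁, hKB10, hKΦ10, hAΦ0, hBΦ0, hP2, hP3]
    gcongr
  case hR =>
    intro X Y U U'
    refine (abs_apply_riemAt_le (G := G) (x := y₀) X Y U U').trans ?_
    have h2 : ‖G y₀‖ * ‖riemCLM G y₀‖ ≤ Kall := by
      have : ‖G y₀‖ * ‖riemCLM G y₀‖ ≤ KG * KR :=
        mul_le_mul (hKG y₀ hy₀) (hKR y₀ hy₀) (norm_nonneg _) hKG0
      rw [hKalldef]; linarith only [this, hC₁, hKB10, hKB20, hKΦ10, hAΦ0, hBΦ0, hP1, hP3]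
    gcongr
  case hDR =>
    intro X Y U U' U''
    refine (hG.abs_apply_covRiemAt_le hy X Y U U' U'').trans ?_
    have h2 : ‖G y₀‖ * (‖fderiv ℝ (riemCLM G) y₀‖ + 4 * ‖chrAt G y₀‖ * ‖riemCLM G y₀‖) ≤ Kall := by
      have : ‖G y₀‖ * (‖fderiv ℝ (riemCLM G) y₀‖ + 4 * ‖chrAt G y₀‖ * ‖riemCLM G y₀‖)
          ≤ KG * (KDR + 4 * KΓ * KR) := by
        refine mul_le_mul (hKG y₀ hy₀) ?_ (by positivity) hKG0
        have := hKDR y₀ hy₀; have := hKΓ y₀ hy₀; have := hKR y₀ hy₀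
        gcongr
      rw [hKalldef]; linarith only [this, hC₁, hKB10, hKB20, hKΦ10, hAΦ0, hBΦ0, hP1, hP2]
    gcongr
  case hΦ1 =>
    intro X
    refine (abs_fderiv_rhs_le hwfd hqfd hfd (1 / 16) (1 / 4) (hKw1 y₀ hy₀) hq0' hq1' hf0 hDf X).trans ?_
    refine mul_le_mul_of_nonneg_right ?_ (norm_nonneg _)
    have : |1 / 16| * Kw1 + |1 / 4| * Kq * Real.exp (4 * C₀) * (1 + 4 * Kd) = KΦ1 := by
      rw [hKΦ1def]
    rw [this, hKalldef]; linarith only [hC₁, hKB10, hKB20, hAΦ0, hBΦ0, hP1, hP2, hP3]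
  case hΦ2 =>
    have h := abs_lapAt_rhs_le hi hs (hwfy.of_le (by norm_cast)) (hqfy.of_le (by norm_cast))
      (hfy.of_le (by norm_cast)) (1 / 16) (1 / 4) hKs0 hw2' hq0' hq1' hq2' hf0 hγ hγ0 hDfn
      (hKs y₀ hy₀)
    refine h.trans ?_
    have hA : |1 / 16| * Kw2 + |1 / 4| * Kq * Real.exp (4 * C₀) * (16 * C₁ + 1 + 8 * Ks * Kd) = AΦ := by
      rw [hAΦdef]
    have hBB : |1 / 4| * Kq * Real.exp (4 * C₀) * 4 = BΦ := by rw [hBΦdef]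
    rw [hA, hBB]
    have hle : AΦ + BΦ ≤ Kall := by
      rw [hKalldef]; linarith only [hC₁, hKB10, hKB20, hKΦ10, hP1, hP2, hP3]
    have habs := abs_nonneg (lapAt G f y₀)
    have h5 : BΦ * |lapAt G f y₀| ≤ Kall * |lapAt G f y₀| :=
      mul_le_mul_of_nonneg_right (by linarith only [hle, hAΦ0]) habs
    linarith only [hle, h5, hBΦ0, habs]
  -- from `|Hess f|² ≤ Cfin` to `Δf ≤ (1 + n Cfin)/2`
  have hNC : normSqAt G y₀ (hessAt G f y₀) ≤ Cfin := by
    have hN' := hN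
    simp only [Fintype.card_fin] at hN'
    rw [hCfin]
    exact hN'
  have hlap : lapAt G f y₀ = ∑ a, hessAt G f y₀ (e a) (e a) := by
    rw [lapAt, mtrAt_eq_sum_frame e he hi]
  have hsq : lapAt G f y₀ ^ 2 ≤ (finrank ℝ E : ℝ) * normSqAt G y₀ (hessAt G f y₀) := by
    rw [hlap, normSqAt_eq_sum_frame e he hi hs]
    have h1 := sq_sum_le_card_mul_sum_sq (s := Finset.univ) (f := fun a ↦ hessAt G f y₀ (e a) (e a))
    simp only [Finset.card_univ, Fintype.card_fin] at h1
    refine h1.trans (mul_le_mul_of_nonneg_left (Finset.sum_le_sum fun a _ ↦ ?_) (by positivity))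
    exact Finset.single_le_sum (f := fun b ↦ hessAt G f y₀ (e a) (e b) ^ 2) (fun _ _ ↦ sq_nonneg _)
      (Finset.mem_univ a)
  have h3 : lapAt G f y₀ ^ 2 ≤ (finrank ℝ E : ℝ) * Cfin := hsq.trans (mul_le_mul_of_nonneg_left hNC (by positivity))
  linarith only [le_half_one_add_sq (lapAt G f y₀), h3]

end MetricCoord

end Literature.Geometry.Lorentzian

end
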